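import Summits.BirchSwinnertonDyer.Rank1Residual.GaloisImage.KatoKuriharaValueGeneralLevelParity
import HarnessLib

/-!
# Route `KimAtThreeKolyvagin` (rung W2), crux `DeepUpperAtThreeOffKatoStratum` (item 19562), stub
# `stub_additiveDefect`: the TWO-EXPONENT value socket of the Kato–Kurihara dictionary at one tame level
# — n1011's parity road (KatoParity §4–§5 → GeneralLevel S3-family → halving) with the (P-EXP) rider's
# scalar clause (ii) replaced by its two-exponent form `p^e · Λfin(loc_v κ₀) = s mod p^{k+1}`

Cell `bsd-addord`, seat `bsd-addord-w2-acc1` (PROGRAMME PART 1b, ACCEL-LIST l.753 row (1): «lattice-index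
bookkeeping: v₃(c₃), #E(ℚ₃)[3], 3 ∣ Manin enter the defect d (Kim 2026 Rem. 3.8)»), item
`stmt-BirchSwinnertonDyer-19562` (owner w2-c5; `--supports` helpers only).  TOOL THEOREMS ONLY: no
definition, no named fact, no instance, no `sorry`; nothing is asserted about any curve; Kato's `ZetaBody`
enters as the displayed HYPOTHESIS `hbody` (never obtained); closes nothing by itself.

## Why (the additive-DEFECT rows: Kodaira IV/IV* `3 ∣ c₃`, `3 ∣ c_P`, `E(ℚ₃)[3] ≠ 0`)

n1011's (P-EXP) rider `KatoExpStarFiniteLevelAt W p k t v Λ Λfin` (PK-5) asks (i) `Λfin` onto `ℤ/p^{k+1}`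
on `𝓕_can(v)` with kernel the Kummer part and (ii) `p^t · Λ_{0,r}(y) ≡ s ⊗ 1 (mod p^{k+1}·L_int) ⟹
Λfin(loc_v κ₀) = s̄`.  On the Kato stratum (`3 ∤ c₃·c_P`, `t = 0`) both hold for Kato's witnesses read in
the `ω_E`-coordinate (D-53-3).  On the additive-DEFECT rows they cannot hold together in ANY coordinate:
the local lattice is `exp*_{ω_E}(H¹(ℚ₃, T₃E)) = 3^{v₃(c₃)−t}ℤ₃` (Kim 2026 §3.2.3 / Thm. 3.6; Rem. 3.8 and
Lemma 3.10 are `p ∤ c_p` only — kim3 memo Lemma L/L′, referee PASS), so the ONTO functional is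
`Λfin = 3^{t−v₃(c₃)}·exp*_{ω_E} mod 3^{k+1}`, while Kato's constant is a `3`-unit exactly in the
`ω_f = c_P⁻¹·ω_E`-coordinate (`Ω(E) = |c_P|·Ω⁺_f` at a lattice-optimal datum).  Reading `Λ` in the
`ω_f`-coordinate (so that the value rows of n1011-p02 `ValueRow.valueRow_of_zetaBody` apply with a UNIT
constant) the true scalar law is `p^e · Λfin(loc_v κ₀) = s̄` with ONE exponent `e = v₃(c₃) + v₃(c_P)` —
acc6's PORT₂ / `KatoKuriharaWitnessAtTwoExp` value clause `3^e·Λ(loc κ_d) = u·3^t·δ̃_{n(d)}`; it is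
consistent by r1's LEMMA SAT (ROUTE-1 §53.3: `(𝓞_K + 3^t·M_K) ∩ ℚ₃ ⊆ ℤ₃`, `t ∈ {0,1}`) BECAUSE `e ≥ v₃(c₃)`.
The whole value-law chain of n1011 consumes clause (ii) exactly once (`KatoExpStarFiniteLevelAt.
apply_localization_eq_toZModPow`), so the two-exponent chain is the same chain with that one call replaced
by the displayed two-exponent clause `hii` (stated INLINE here; at `e = 0` it IS clause (ii) — nothing
landed is contradicted; acc6's reviewed predicate `KatoExpStarFiniteLevelAtTwoExp`, when it lands, projects
to it by `.2.2`).

## What (generic prime `p`, depth `k`, exponents `t e`, place `v`)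

* `apply_localization_add_self_eq_toZModPow_twoExp` — KatoParity §4 twin: `hii` at the symmetrised pair
  `(y + g·y, κ₀ + κ₀)`: `p^e · Λfin(loc_v (κ₀ + κ₀)) = s̄`.
* `apply_localization_add_self_eq_toZModPow_of_zetaBody_deriv_twoExp` — KatoParity §5 twin for THEOREM
  A3's derivative `y = D · z_{0,r}`, premise on the pure tensor `1 ⊗ D^{field}(x_{0,r} + σ₋₁ x_{0,r})`
  (n1011-p02 ★ `ZetaValue.zetaBody_apply_deriv_zeta_add_conjMap_eq_tmul_deriv`).
* `apply_localization_add_self_eq_toZModPow_of_derivativeFamily_twoExp` — GeneralLevel S3-family twin in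
  THEOREM D's literal currency (D4/D6/D6b/D7 output `σ Φ comm κ hΦ hKS hres`), by (S1)
  `resSubgroup_eq_comp_map_deriv`, (S2) `localization_mem_of_isKolyvaginSystem`, the pin glue
  `comp_oneCocycleClass_eq_of_pin`, `pairwise_commute_tateDeriv` and a conjugation with `χ_n(g) = −1`
  obtained inside (`KatoParity.exists_modNCyclotomicCharacter_eq_neg_one`).
* ★ `exists_unit_apply_localization_eq_of_derivativeFamily_twoExp` — with the unit reading of the scalar
  (`s̄ = w · p^t · δ̃`, T-PK6-VAL (V4)): **`∃ u ∈ (ℤ/p^{k+1})ˣ, p^e · Λfin(loc_v κ_r) = u · p^t · δ̃`** for THEOREM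
  D's own class `κ_r` (`p` odd; halving by `KatoParity.isUnit_two_zmod_pow`) — the two-exponent (DICT3)
  clause of acc6's `KimAtThreeKolyvaginDefs.KatoKuriharaWitnessAtTwoExp` at the level `r`.
References: [Kato2004Asterisque] §9.4 p. 188, Thm. 9.7 p. 189; [Kim2022StructureSelmer] §3.2.3, Thm. 3.6,
Rem. 3.8, §3.4.1 and the proof of Thm. 3.13 (arXiv v3 pp. 16–18, 26–27); [MazurRubin2004] Thm. 3.2.4,
App. A; [Rubin2000] Def. 4.4.4; design `cells/n1011/ROUTE-1.md` §53 (D-53-1 … D-53-7, LEMMA SAT), §58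
D-58-1; kim3 memo KIM3-PROOF §4.2 Lemma L/L′.
-/

noncomputable section

-- the Theorems namespace of a single-conjunct summit repeats the summit name by design (D-0017)
set_option linter.dupNamespace false

open scoped NumberField TensorProduct
open CategoryTheory Field Finset IsDedekindDomain NumberField WeierstrassCurve Rat.HeightOneSpectrum
open Literature.NumberTheory.GaloisRepresentations Literature.NumberTheory.GaloisCohomology
open Literature.NumberTheory.GaloisRepresentations.DiscreteGaloisModule
open Literature.NumberTheory.EllipticCurves Literature.NumberTheory.EllipticCurves.Kato2004
open Literature.NumberTheory.EllipticCurves.Kato2004.EulerSystemValues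
open Summit.BirchSwinnertonDyer.Rank1Residual.GaloisImage

namespace Summit.BirchSwinnertonDyer.BirchSwinnertonDyer.Theorems.KimAtThreeTwoExpValueSocket

/-! ### §1 The two-exponent scalar clause (ii)ₑ at the symmetrised pair -/

section Rider

variable {W : WeierstrassCurve ℚ} [W.IsElliptic] {p : ℕ} [Fact p.Prime]
  [ContinuousSMul ℤ_[p] (W.tateModule p)] {k t e : ℕ} {v : HeightOneSpectrum (𝓞 ℚ)}
  {Λ : ∀ (k' : ℕ) (r : Finset (HeightOneSpectrum (𝓞 ℚ))),
    H1 (tateRep W p) (cycSubgroup p k' r) →ₗ[ℤ_[p]] ℚ_[p] ⊗[ℚ] CyclotomicField (cycLevel p k' r) ℚ}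
  {Λfin : galoisCohomology ((W.torsionGaloisModule ((p : ℤ) ^ k * (p : ℤ))).toLocal
    (Sum.inr v)) 1 →+ ZMod (p ^ (k + 1))}

/-- **The TWO-EXPONENT scalar compatibility at the plus-symmetrised pair** (KatoParity §4 twin).  The
displayed clause `hii` — n1011's (P-EXP) rider clause (ii) with conclusion `p^e · Λfin(loc_v κ₀) = s̄`
(the two-exponent form; `e = 0` is the rider's own clause) — applied at `(y + g·y, κ₀ + κ₀)` for EVERY
`g`: `res (κ₀ + κ₀) = Ψ (y + g·y)` by (T⁺1) `KatoParity.resSubgroup_add_self_eq_apply_add_conjMap`,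
`loc_v (κ₀ + κ₀) ∈ 𝓕_can(v)` by `add_mem`.
[cite: Kim2022StructureSelmer, §3.4.1 and the proof of Thm. 3.13 (arXiv v3 pp. 26–27; = Thm. 3.11 of AJM 148)]
[cite: Rubin2000, Def. 4.4.4 and Lemma 4.4.2] -/
theorem apply_localization_add_self_eq_toZModPow_twoExp
    (hii : ∀ (r : Finset (HeightOneSpectrum (𝓞 ℚ)))
      (Ψ : H1 (tateRep W p) (cycSubgroup p 0 r) →+
        continuousCohomology 1
          (subgroupRep (W.torsionGaloisModule ((p : ℤ) ^ k * (p : ℤ))).toTopRep (cycSubgroup p 0 r))),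
      (∀ (φ : contOneCocycles (subgroupRep (tateRep W p).toTopRep (cycSubgroup p 0 r)))
          (ψ : contOneCocycles
            (subgroupRep (W.torsionGaloisModule ((p : ℤ) ^ k * (p : ℤ))).toTopRep (cycSubgroup p 0 r))),
          (∀ g, ((ψ.1 g : geomTorsion W ((p : ℤ) ^ k * (p : ℤ))) : geomPoints W) =
            TateModule.proj p (k + 1) (φ.1 g)) →
          Ψ (oneCocycleClass _ φ) = oneCocycleClass _ ψ) →
      ∀ (y : H1 (tateRep W p) (cycSubgroup p 0 r))
        (κ₀ : galoisCohomology (W.torsionGaloisModule ((p : ℤ) ^ k * (p : ℤ))) 1) (s : ℤ_[p]),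
        resSubgroup (W.torsionGaloisModule ((p : ℤ) ^ k * (p : ℤ))).toTopRep (cycSubgroup p 0 r) 1 κ₀ =
            Ψ y →
        galoisCohomology.localization (W.torsionGaloisModule ((p : ℤ) ^ k * (p : ℤ))) (Sum.inr v) 1 κ₀ ∈
            propagatedSelmerStructure W p k (Sum.inr v) →
        (∃ l ∈ cycIntLattice p (cycLevel p 0 r),
            ((p : ℤ_[p]) ^ t) • Λ 0 r y - ((s : ℚ_[p]) ⊗ₜ[ℚ] (1 : CyclotomicField (cycLevel p 0 r) ℚ)) =
              ((p : ℤ_[p]) ^ (k + 1)) • (l : ℚ_[p] ⊗[ℚ] CyclotomicField (cycLevel p 0 r) ℚ)) →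
        ((p ^ e : ℕ) : ZMod (p ^ (k + 1))) *
          Λfin (galoisCohomology.localization (W.torsionGaloisModule ((p : ℤ) ^ k * (p : ℤ)))
            (Sum.inr v) 1 κ₀) = PadicInt.toZModPow (k + 1) s)
    (r : Finset (HeightOneSpectrum (𝓞 ℚ)))
    (Ψ : H1 (tateRep W p) (cycSubgroup p 0 r) →+
      continuousCohomology 1
        (subgroupRep (W.torsionGaloisModule ((p : ℤ) ^ k * (p : ℤ))).toTopRep (cycSubgroup p 0 r)))
    (hΨ : ∀ (φ : contOneCocycles (subgroupRep (tateRep W p).toTopRep (cycSubgroup p 0 r)))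
        (ψ : contOneCocycles
          (subgroupRep (W.torsionGaloisModule ((p : ℤ) ^ k * (p : ℤ))).toTopRep (cycSubgroup p 0 r))),
        (∀ g, ((ψ.1 g : geomTorsion W ((p : ℤ) ^ k * (p : ℤ))) : geomPoints W) =
          TateModule.proj p (k + 1) (φ.1 g)) →
        Ψ (oneCocycleClass _ φ) = oneCocycleClass _ ψ)
    (g : absoluteGaloisGroup ℚ) (y : H1 (tateRep W p) (cycSubgroup p 0 r))
    (κ₀ : galoisCohomology (W.torsionGaloisModule ((p : ℤ) ^ k * (p : ℤ))) 1) (s : ℤ_[p])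
    (hres : resSubgroup (W.torsionGaloisModule ((p : ℤ) ^ k * (p : ℤ))).toTopRep (cycSubgroup p 0 r)
      1 κ₀ = Ψ y)
    (hloc : galoisCohomology.localization (W.torsionGaloisModule ((p : ℤ) ^ k * (p : ℤ))) (Sum.inr v)
      1 κ₀ ∈ propagatedSelmerStructure W p k (Sum.inr v))
    (hval : ∃ l ∈ cycIntLattice p (cycLevel p 0 r),
      ((p : ℤ_[p]) ^ t) • Λ 0 r (y + conjMap (tateRep W p).toTopRep (cycSubgroup p 0 r) g 1 y) -
          ((s : ℚ_[p]) ⊗ₜ[ℚ] (1 : CyclotomicField (cycLevel p 0 r) ℚ)) =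
        ((p : ℤ_[p]) ^ (k + 1)) • (l : ℚ_[p] ⊗[ℚ] CyclotomicField (cycLevel p 0 r) ℚ)) :
    ((p ^ e : ℕ) : ZMod (p ^ (k + 1))) *
      Λfin (galoisCohomology.localization (W.torsionGaloisModule ((p : ℤ) ^ k * (p : ℤ)))
        (Sum.inr v) 1 (κ₀ + κ₀)) = PadicInt.toZModPow (k + 1) s :=
  hii r Ψ hΨ _ (κ₀ + κ₀) s
    (KatoParity.resSubgroup_add_self_eq_apply_add_conjMap _ Ψ hΨ g y κ₀ hres)
    (KatoParity.localization_add_self_mem hloc) hval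

end Rider

/-! ### §2 With Kato's `ZetaBody`: the premise in VALUE form (THEOREM A3's derivative) -/

section Zeta

variable {W : WeierstrassCurve ℚ} [W.IsElliptic] {p : ℕ} [Fact p.Prime]
  [ContinuousSMul ℤ_[p] (W.tateModule p)] [Module.Free ℤ_[p] (W.tateModule p)]
  [Module.Finite ℤ_[p] (W.tateModule p)] {N : ℕ} {f : CuspForm (CongruenceSubgroup.Gamma0 N) 2}
  {ι : (m : ℕ) → (CyclotomicField m ℚ →+* ℂ)} {κK : ℝ}
  {Λ : ∀ (k' : ℕ) (r : Finset (HeightOneSpectrum (𝓞 ℚ))),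
    H1 (tateRep W p) (cycSubgroup p k' r) →ₗ[ℤ_[p]] ℚ_[p] ⊗[ℚ] CyclotomicField (cycLevel p k' r) ℚ}
  {c d a : ℤ} {A : ℕ}
  {z : ∀ (k' : ℕ) (r : (cyclotomicLevelsRat p (badPlaces c d A N)).Ideals),
    H1 (tateRep W p) ((cyclotomicLevelsRat p (badPlaces c d A N)).level k' r.1)}
  {x : ∀ (k' : ℕ) (r : (cyclotomicLevelsRat p (badPlaces c d A N)).Ideals),
    CyclotomicField (cycLevel p k' r.1) ℚ}
  {k t e : ℕ} {v : HeightOneSpectrum (𝓞 ℚ)}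
  {Λfin : galoisCohomology ((W.torsionGaloisModule ((p : ℤ) ^ k * (p : ℤ))).toLocal
    (Sum.inr v)) 1 →+ ZMod (p ^ (k + 1))}

/-- **KatoParity §5 twin (two exponents), THEOREM A3's derivative `y = D · z_{0,r}`**: under `hbody` and
the two-exponent clause `hii`, for `g` with `χ_n(g) = −1`, from `res κ₀ = Ψ (D · z_{0,r})`,
`loc_v κ₀ ∈ 𝓕_can(v)` and the premise on the PURE TENSOR `p^t · (1 ⊗ D^{field}(x_{0,r} + σ₋₁ x_{0,r}))
≡ s ⊗ 1 (mod p^{k+1}·L_int)`: `p^e · Λfin(loc_v (κ₀ + κ₀)) = s̄` (the value of `y + g·y` is n1011-p02's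
`ZetaValue.zetaBody_apply_deriv_zeta_add_conjMap_eq_tmul_deriv`).
[cite: Kato2004Asterisque, Thm. 9.7 (p. 189) and §9.4 (p. 188)]
[cite: Kim2022StructureSelmer, §3.4.1 and the proof of Thm. 3.13 (arXiv v3 pp. 26–27; = Thm. 3.11 of AJM 148)] -/
theorem apply_localization_add_self_eq_toZModPow_of_zetaBody_deriv_twoExp
    (hbody : ZetaBody W p f ι κK Λ c d a A z x)
    (hii : ∀ (r : Finset (HeightOneSpectrum (𝓞 ℚ)))
      (Ψ : H1 (tateRep W p) (cycSubgroup p 0 r) →+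
        continuousCohomology 1
          (subgroupRep (W.torsionGaloisModule ((p : ℤ) ^ k * (p : ℤ))).toTopRep (cycSubgroup p 0 r))),
      (∀ (φ : contOneCocycles (subgroupRep (tateRep W p).toTopRep (cycSubgroup p 0 r)))
          (ψ : contOneCocycles
            (subgroupRep (W.torsionGaloisModule ((p : ℤ) ^ k * (p : ℤ))).toTopRep (cycSubgroup p 0 r))),
          (∀ g, ((ψ.1 g : geomTorsion W ((p : ℤ) ^ k * (p : ℤ))) : geomPoints W) =
            TateModule.proj p (k + 1) (φ.1 g)) →
          Ψ (oneCocycleClass _ φ) = oneCocycleClass _ ψ) →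
      ∀ (y : H1 (tateRep W p) (cycSubgroup p 0 r))
        (κ₀ : galoisCohomology (W.torsionGaloisModule ((p : ℤ) ^ k * (p : ℤ))) 1) (s : ℤ_[p]),
        resSubgroup (W.torsionGaloisModule ((p : ℤ) ^ k * (p : ℤ))).toTopRep (cycSubgroup p 0 r) 1 κ₀ =
            Ψ y →
        galoisCohomology.localization (W.torsionGaloisModule ((p : ℤ) ^ k * (p : ℤ))) (Sum.inr v) 1 κ₀ ∈
            propagatedSelmerStructure W p k (Sum.inr v) →
        (∃ l ∈ cycIntLattice p (cycLevel p 0 r),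
            ((p : ℤ_[p]) ^ t) • Λ 0 r y - ((s : ℚ_[p]) ⊗ₜ[ℚ] (1 : CyclotomicField (cycLevel p 0 r) ℚ)) =
              ((p : ℤ_[p]) ^ (k + 1)) • (l : ℚ_[p] ⊗[ℚ] CyclotomicField (cycLevel p 0 r) ℚ)) →
        ((p ^ e : ℕ) : ZMod (p ^ (k + 1))) *
          Λfin (galoisCohomology.localization (W.torsionGaloisModule ((p : ℤ) ^ k * (p : ℤ)))
            (Sum.inr v) 1 κ₀) = PadicInt.toZModPow (k + 1) s)
    (r : (cyclotomicLevelsRat p (badPlaces c d A N)).Ideals)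
    (Ψ : H1 (tateRep W p) (cycSubgroup p 0 r.1) →+
      continuousCohomology 1
        (subgroupRep (W.torsionGaloisModule ((p : ℤ) ^ k * (p : ℤ))).toTopRep (cycSubgroup p 0 r.1)))
    (hΨ : ∀ (φ : contOneCocycles (subgroupRep (tateRep W p).toTopRep (cycSubgroup p 0 r.1)))
        (ψ : contOneCocycles
          (subgroupRep (W.torsionGaloisModule ((p : ℤ) ^ k * (p : ℤ))).toTopRep
            (cycSubgroup p 0 r.1))),
        (∀ g, ((ψ.1 g : geomTorsion W ((p : ℤ) ^ k * (p : ℤ))) : geomPoints W) =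
          TateModule.proj p (k + 1) (φ.1 g)) →
        Ψ (oneCocycleClass _ φ) = oneCocycleClass _ ψ)
    {ι' : Type*} (σ : ι' → absoluteGaloisGroup ℚ) (Nℓ : ι' → ℕ) (s' : Finset ι') (comm)
    {g : absoluteGaloisGroup ℚ} (hg : modNCyclotomicCharacter ℚ (cycLevel p 0 r.1) g = -1)
    (κ₀ : galoisCohomology (W.torsionGaloisModule ((p : ℤ) ^ k * (p : ℤ))) 1) (s : ℤ_[p])
    (hres : resSubgroup (W.torsionGaloisModule ((p : ℤ) ^ k * (p : ℤ))).toTopRep (cycSubgroup p 0 r.1)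
      1 κ₀ = Ψ (s'.noncommProd (fun ℓ => ∑ j ∈ Finset.range (Nℓ ℓ),
        (j : Module.End ℤ_[p] (H1 (tateRep W p) (cycSubgroup p 0 r.1))) *
          (conjMap (tateRep W p).toTopRep (cycSubgroup p 0 r.1) (σ ℓ) 1).hom.toLinearMap ^ j) comm
            (z 0 r)))
    (hloc : galoisCohomology.localization (W.torsionGaloisModule ((p : ℤ) ^ k * (p : ℤ))) (Sum.inr v)
      1 κ₀ ∈ propagatedSelmerStructure W p k (Sum.inr v))
    (hval : ∃ l ∈ cycIntLattice p (cycLevel p 0 r.1),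
      ((p : ℤ_[p]) ^ t) • ((1 : ℚ_[p]) ⊗ₜ[ℚ]
        (s'.noncommProd (fun ℓ => ∑ j ∈ Finset.range (Nℓ ℓ),
            (j : Module.End ℚ (CyclotomicField (cycLevel p 0 r.1) ℚ)) *
              (sigma (cycLevel p 0 r.1) (modNCyclotomicCharacter ℚ (cycLevel p 0 r.1) (σ ℓ)) :
                CyclotomicField (cycLevel p 0 r.1) ℚ →ₐ[ℚ]
                  CyclotomicField (cycLevel p 0 r.1) ℚ).toLinearMap ^ j)
            (ZetaValue.pairwise_commute_fieldDeriv (cycLevel p 0 r.1)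
              (fun ℓ => modNCyclotomicCharacter ℚ (cycLevel p 0 r.1) (σ ℓ)) Nℓ s')
          (x 0 r + sigma (cycLevel p 0 r.1) (-1) (x 0 r)))) -
          ((s : ℚ_[p]) ⊗ₜ[ℚ] (1 : CyclotomicField (cycLevel p 0 r.1) ℚ)) =
        ((p : ℤ_[p]) ^ (k + 1)) • (l : ℚ_[p] ⊗[ℚ] CyclotomicField (cycLevel p 0 r.1) ℚ)) :
    ((p ^ e : ℕ) : ZMod (p ^ (k + 1))) *
      Λfin (galoisCohomology.localization (W.torsionGaloisModule ((p : ℤ) ^ k * (p : ℤ)))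
        (Sum.inr v) 1 (κ₀ + κ₀)) = PadicInt.toZModPow (k + 1) s := by
  refine apply_localization_add_self_eq_toZModPow_twoExp hii r.1 Ψ hΨ g _ κ₀ s hres hloc ?_
  rwa [ZetaValue.zetaBody_apply_deriv_zeta_add_conjMap_eq_tmul_deriv W p f ι κK Λ c d a A z x hbody 0
    r σ Nℓ s' comm hg]

end Zeta

end Summit.BirchSwinnertonDyer.BirchSwinnertonDyer.Theorems.KimAtThreeTwoExpValueSocket

end
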